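import Mathlib
import Summits.NavierStokesRegularity.NavierStokesRegularity.Theorems.EulerZoomLiouvillePowerGaugeEulerLiouvilleSelfSimilarOwnRateUpperPast
import HarnessLib

/-!
# THE TWO-SIDED OWN-RATE ENERGY LAW for the residual power clocks `g ∈ [2/5, ½]`: the own-rate normalised energy `L^{2/g−5}∫σ(L⁻¹y)|V|²` CONVERGES
# (Bronzi–Shvydkoy 2015 Thm 1.1 / Rem 1.4 at the clock's own rate, with the CLASS-`ρ` dissipation and pressure data)
# (crux `EulerZoomLiouville.PowerGaugeEulerLiouville` = stmt-NavierStokesRegularity-19832; line `logtime-breathers`, residue T4 `stub_powerClockRest`)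

Width seat `ns-ezl-w6` (cell ns-regularity-ideate, LEAD ns-typeII-p2).  Completes the census of the v53/v55 residue window `g ∈ [2/5, 1/(2+ρ)]`
(`…SelfSimilarOwnRateSubExtremalPast`: vanish or own-rate extremal from below; `…SelfSimilarOwnRateUpperPast`: own-rate upper law up to `δ`): the normalised
energy `Ñ_σ(L) = L^{κ} ∫σ(L⁻¹y)|V|²`, `κ = 2/g − 5`, has a LIMIT `N_∞ ≥ 0` as `L → ∞`, for every cut-off `σ`.  Mechanism: the scale ODE
`Ñ_σ' = g⁻¹ L^{κ−1} F_σ` (`…EnergySaturationScaleODE`), the own-rate upper law (`ownRate_iterate_floor` with `δ = min ρ ((1−2ρ+κ)/2)` when the floor lies below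
the class exponent, the class bound itself otherwise) and the flux bound through the tail supremum make the flux weight `O(L^{κ/2 + δ/2 − 5ρ/4 − 1})`,
integrable at infinity (`κ ≤ 0`).  Then `N_∞ = 0` forces `V = 0` (`ae_eq_zero_of_ownRate_subExtremal_loc`), so a surviving clock has
`∫σ(L⁻¹y)|W|² ∼ N_∞ L^{5−2/g}`, `N_∞ > 0`.

* `EnergySaturation.continuousAt_ownRate_fluxWeight` — `r ↦ g⁻¹ r^{κ−1} F_σ(r)` is continuous on `(0,∞)` (it is the scale derivative of `Ñ_σ`);
* `EnergySaturation.exists_admissible_bound_ownRate` — pure real: an admissible power bound `J ≤ C R^m` with `κ + (m/2 − 5ρ/4) < 0`;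
* `EnergySaturation.tendsto_ownRate_normEnergy_loc` — profile level: class-`ρ` data + Poisson + rate-`g` local energy equality (`2/5 ≤ g`) ⇒
  `Ñ_σ(L) → N_∞`;
* `SlowClock.tendsto_ownRate_normEnergy_past` — member level for past/shifted clocks of rate `g ∈ [2/5, ½]`.

WHAT THIS IS NOT: not NS, not E — the two-sided energy law of one residue of the crux CLASS 19832 on the MODEL lattice; own-rate-extremal clocks remain OPEN;
`--supports` stmt-19832. [folklore; cf. BronziShvydkoy2015 Thm 1.1, Rem 1.4]
-/

noncomputable section

-- flat `Theorems/<Route><Decl>…` files of one crux share the namespace of the crux (tree convention: `Summit.<S>.<S>.…`)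
set_option linter.dupNamespace false

open MeasureTheory Set Filter Topology Metric Function TopologicalSpace
open scoped ENNReal NNReal RealInnerProductSpace ContDiff Laplacian

namespace Summit.NavierStokesRegularity.NavierStokesRegularity.Theorems.PowerGaugeEulerLiouville

open Literature.Analysis Literature.Analysis.FunctionSpaces Literature.Analysis.FluidPDE

namespace EnergySaturation

/-! ## Continuity of the own-rate flux weight -/

section Continuity

variable {g : ℝ} {σ : EuclideanSpace ℝ (Fin 3) → ℝ}
  {V : EuclideanSpace ℝ (Fin 3) → EuclideanSpace ℝ (Fin 3)} {P : EuclideanSpace ℝ (Fin 3) → ℝ}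

/-- **The own-rate flux weight is continuous on `(0, ∞)`.**  Under the rate-`g` local energy equality at every rescaled cut-off (`g ≠ 0`),
`r ↦ g⁻¹ r^{2/g−6} F_σ(r)` coincides on `(0,∞)` with the scale derivative of `L^{2/g−5}∫σ(L⁻¹y)|V|²`, which is
`(2/g−5) r^{2/g−6} ∫σ_r|V|² + r^{2/g−5} d/dr∫σ_r|V|²`, a continuous function. [folklore] -/
theorem continuousAt_ownRate_fluxWeight (hg : g ≠ 0)
    (hσ : IsTestFunctionOn (⊤ : Opens (EuclideanSpace ℝ (Fin 3))) σ)
    (hVm : AEStronglyMeasurable V volume)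
    (hV2 : LocallyIntegrable (fun y => ‖V y‖ ^ 2) volume)
    (hEE : ∀ L : ℝ, 0 < L → (2 - 5 * g) * ∫ x, σ (L⁻¹ • x) * ‖V x‖ ^ 2 =
      (∫ x, (‖V x‖ ^ 2 + 2 * P x) * ⟪V x, gradient (fun z => σ (L⁻¹ • z)) x⟫) +
        g * ∫ x, ‖V x‖ ^ 2 * ⟪x, gradient (fun z => σ (L⁻¹ • z)) x⟫)
    {L : ℝ} (hL : 0 < L) :
    ContinuousAt (fun r : ℝ => g⁻¹ * r ^ (2 / g - 6) *
      ∫ x, (‖V x‖ ^ 2 + 2 * P x) * ⟪V x, gradient (fun z => σ (r⁻¹ • z)) x⟫) L := by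
  -- adapted from `continuousAt_fluxWeight` (…EnergySaturationFlux), exponent `2ρ−1 ↦ 2/g−5`
  have hσ1 : ContDiff ℝ 1 σ := hσ.contDiff.of_le (by norm_cast)
  have hcont : ContinuousAt (fun r : ℝ => (2 / g - 5) * r ^ (2 / g - 5 - 1) * (∫ y, σ (r⁻¹ • y) * ‖V y‖ ^ 2)
      + r ^ (2 / g - 5) * ∫ y, (-(r ^ 2)⁻¹ * fderiv ℝ σ (r⁻¹ • y) y) * ‖V y‖ ^ 2) L := by
    have hI : ContinuousAt (fun r : ℝ => ∫ y, σ (r⁻¹ • y) * ‖V y‖ ^ 2) L :=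
      (hasDerivAt_cutoffEnergy hσ1 hσ.hasCompactSupport hVm hV2 hL).2.continuousAt
    have hI' := continuousAt_cutoffEnergyDeriv hσ1 hσ.hasCompactSupport hVm hV2 hL
    have hp1 : ContinuousAt (fun r : ℝ => r ^ (2 / g - 5 - 1)) L :=
      Real.continuousAt_rpow_const _ _ (Or.inl hL.ne')
    have hp2 : ContinuousAt (fun r : ℝ => r ^ (2 / g - 5)) L :=
      Real.continuousAt_rpow_const _ _ (Or.inl hL.ne')
    exact ((continuousAt_const.mul hp1).mul hI).add (hp2.mul hI')
  refine hcont.congr ?_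
  filter_upwards [Ioi_mem_nhds hL] with r hr
  have hr0 : 0 < r := hr
  have hd1 := hasDerivAt_rpowMul_cutoffEnergy_of_energyEquality hg hσ hVm hV2 hr0 (hEE r hr0)
  have hpow : HasDerivAt (fun L : ℝ => L ^ (2 / g - 5)) ((2 / g - 5) * r ^ (2 / g - 5 - 1)) r :=
    Real.hasDerivAt_rpow_const (Or.inl hr0.ne')
  have hd2 : HasDerivAt (fun L : ℝ => L ^ (2 / g - 5) * ∫ y, σ (L⁻¹ • y) * ‖V y‖ ^ 2)
      ((2 / g - 5) * r ^ (2 / g - 5 - 1) * (∫ y, σ (r⁻¹ • y) * ‖V y‖ ^ 2) +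
        r ^ (2 / g - 5) * ∫ y, (-(r ^ 2)⁻¹ * fderiv ℝ σ (r⁻¹ • y) y) * ‖V y‖ ^ 2) r :=
    hpow.mul (hasDerivAt_cutoffEnergy hσ1 hσ.hasCompactSupport hVm hV2 hr0).2
  exact (hd1.unique hd2).symm

end Continuity

/-! ## An admissible power bound below the integrability threshold -/

section Admissible

variable {ρ g : ℝ} {c : ℝ≥0} {A : ℝ} {J F : ℝ → ℝ}

/-- **An admissible power bound with integrable flux weight** (pure real; `c > 0`, `2/5 ≤ g`, i.e. `κ = 2/g−5 ≤ 0`, `0 < ρ`): there is an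
admissible bound `J ≤ C R^m` on `[L₁,∞)` (`m ≤ 1−2ρ`, `C r^{m−(1−2ρ)} ≤ 3c`) with `κ + (m/2 − 5ρ/4) < 0` — the class bound itself when the own-rate floor
`−κ` lies above `1 − 2ρ` (`g ≥ 1/(2+ρ)`), else the own-rate upper law with margin `δ = min ρ ((1−2ρ+κ)/2)`. [folklore] -/
theorem exists_admissible_bound_ownRate (hρ : 0 < ρ) (hg0 : 0 < g) (hκ0 : 2 / g - 5 ≤ 0) (hc : 0 < (c : ℝ))
    (hA0 : 0 ≤ A) (hJ0 : ∀ R : ℝ, 0 < R → 0 ≤ J R)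
    (hflux : ∀ S : ℝ, 0 ≤ S → S ≤ 3 * c → ∀ L : ℝ, 1 ≤ L →
      (∀ R : ℝ, L ≤ R → J R ≤ R ^ (1 - 2 * ρ) * S) →
      ∀ r : ℝ, L ≤ r → |(2 + ρ) * r ^ (2 * ρ - 2) * F r| ≤ A * S ^ (1 / 2 : ℝ) * r ^ (-1 - (2 + ρ) / 4))
    (hderiv : ∀ r : ℝ, 0 < r →
      HasDerivAt (fun L : ℝ => L ^ (2 / g - 5) * J L) (g⁻¹ * r ^ (2 / g - 6) * F r) r)
    {C₀ : ℝ} (hC₀ : 0 ≤ C₀) (hC₀3 : C₀ ≤ 3 * c)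
    (hbase : ∀ R : ℝ, 1 ≤ R → J R ≤ C₀ * R ^ (1 - 2 * ρ)) :
    ∃ m C L₁ : ℝ, m ≤ 1 - 2 * ρ ∧ 0 ≤ C ∧ 1 ≤ L₁ ∧ (∀ R : ℝ, L₁ ≤ R → J R ≤ C * R ^ m) ∧
      (∀ r : ℝ, L₁ ≤ r → C * r ^ (m - (1 - 2 * ρ)) ≤ 3 * c) ∧ (2 / g - 5) + (m / 2 - 5 * ρ / 4) < 0 := by
  set κ : ℝ := 2 / g - 5 with hκ
  by_cases hfloor : 1 - 2 * ρ + κ ≤ 0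
  · -- the class bound is admissible and already below the threshold
    refine ⟨1 - 2 * ρ, C₀, 1, le_rfl, hC₀, le_rfl, hbase, fun r hr => ?_, ?_⟩
    · rw [sub_self, Real.rpow_zero, mul_one]; exact hC₀3
    · linarith
  · push Not at hfloor
    set δ : ℝ := min ρ ((1 - 2 * ρ + κ) / 2) with hδ
    have hδ0 : 0 < δ := lt_min hρ (by linarith)
    have hδρ : δ ≤ ρ := min_le_left _ _
    have hδκ : δ ≤ (1 - 2 * ρ + κ) / 2 := min_le_right _ _
    obtain ⟨C, L₁, hC, hL₁, hb⟩ := ownRate_iterate_floor hρ hg0 hκ0 hδ0 hc hA0 hJ0 hflux hderiv hC₀ hC₀3 hbase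
    set t : ℝ := -(2 / g - 5) + δ with ht
    have htlt : t - (1 - 2 * ρ) < 0 := by rw [ht]; linarith
    -- enlarge the threshold so that the tail suprema are admissible
    have htend : Tendsto (fun r : ℝ => C * r ^ (t - (1 - 2 * ρ))) atTop (𝓝 (C * 0)) := by
      refine tendsto_const_nhds.mul ?_
      have := tendsto_rpow_neg_atTop (y := -(t - (1 - 2 * ρ))) (by linarith)
      simpa using this
    rw [mul_zero] at htend
    have h3c0 : (0 : ℝ) < 3 * c := by positivity
    obtain ⟨L₂, hL₂δ, hL₂ge⟩ := ((htend.eventually (gt_mem_nhds h3c0)).and (eventually_ge_atTop L₁)).exists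
    have hL₂1 : 1 ≤ L₂ := hL₁.trans hL₂ge
    have hL₂0 : 0 < L₂ := lt_of_lt_of_le one_pos hL₂1
    refine ⟨t, C, L₂, by linarith, hC, hL₂1, fun R hR => hb R (hL₂ge.trans hR), fun r hr => ?_, ?_⟩
    · have hmono : r ^ (t - (1 - 2 * ρ)) ≤ L₂ ^ (t - (1 - 2 * ρ)) :=
        Real.rpow_le_rpow_of_nonpos hL₂0 hr htlt.le
      calc C * r ^ (t - (1 - 2 * ρ)) ≤ C * L₂ ^ (t - (1 - 2 * ρ)) := mul_le_mul_of_nonneg_left hmono hC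
        _ ≤ 3 * c := hL₂δ.le
    · rw [ht]; linarith

end Admissible

/-! ## The two-sided own-rate law (profile level) -/

variable {ρ g : ℝ} {σ : EuclideanSpace ℝ (Fin 3) → ℝ}
  {V : EuclideanSpace ℝ (Fin 3) → EuclideanSpace ℝ (Fin 3)} {P : EuclideanSpace ℝ (Fin 3) → ℝ}
  {G : EuclideanSpace ℝ (Fin 3) → EuclideanSpace ℝ (Fin 3) →L[ℝ] EuclideanSpace ℝ (Fin 3)}

/-- **THE OWN-RATE NORMALISED ENERGY CONVERGES (profile level).**  Under the thresholded class data (A₁), (E₁), (D₁) of DATA exponent `0 < ρ < 1`, the weak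
Poisson equation and the profile local energy EQUALITY of a collapse of rate `g ≥ 2/5` (literal shape), for every cut-off `σ` with `0 ≤ σ ≤ 1`, `σ = 1`
on `B̄₁`, `σ = 0` off `B₂`: `Ñ_σ(L) = L^{2/g−5}∫σ(L⁻¹y)|V|²` has a limit as `L → ∞` (the two-sided law of Bronzi–Shvydkoy 2015 Thm 1.1 / Rem 1.4 at the clock's
own rate; `g = 1/(2+ρ)` is `tendsto_normEnergy_loc`). [folklore; cf. BronziShvydkoy2015 Thm 1.1] -/
theorem tendsto_ownRate_normEnergy_loc (hρ : 0 < ρ) (hρ1 : ρ < 1) (hg25 : 2 / 5 ≤ g)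
    (hσ : IsTestFunctionOn (⊤ : Opens (EuclideanSpace ℝ (Fin 3))) σ) (h0 : ∀ z, 0 ≤ σ z)
    (h1 : ∀ z, σ z ≤ 1) (hone : ∀ z, ‖z‖ ≤ 1 → σ z = 1) (hzero : ∀ z, 2 ≤ ‖z‖ → σ z = 0)
    (hVm : AEStronglyMeasurable V volume) (hPm : AEStronglyMeasurable P volume)
    (hGm : AEStronglyMeasurable G volume)
    (hVG : HasWeakFDerivOn (⊤ : Opens (EuclideanSpace ℝ (Fin 3))) volume V G) {c : ℝ≥0}
    (hA : ∀ L : ℝ, 1 ≤ L → ∫⁻ y in ball (0 : EuclideanSpace ℝ (Fin 3)) L, ‖V y‖ₑ ^ 2 ≤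
      (c : ℝ≥0∞) * ENNReal.ofReal (L ^ (1 - 2 * ρ)))
    (hE : ∀ L : ℝ, 1 ≤ L →
      ∫⁻ y in ball (0 : EuclideanSpace ℝ (Fin 3)) L, ENNReal.ofReal (frobeniusNormSq (G y)) ≤
        ENNReal.ofReal (L ^ (1 - ρ)) * (ENNReal.ofReal ((1 - ρ) / (2 + ρ)) * (c : ℝ≥0∞)))
    (hD : ∀ L : ℝ, 1 ≤ L →
      ∫⁻ y in ball (0 : EuclideanSpace ℝ (Fin 3)) L, ‖P y‖ₑ ^ (3 / 2 : ℝ) ≤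
        ENNReal.ofReal (L ^ (2 - 2 * ρ)) * (ENNReal.ofReal ((2 - 2 * ρ) / (2 + ρ)) * (c : ℝ≥0∞)))
    (hPoisson : ∀ θ : EuclideanSpace ℝ (Fin 3) → ℝ, ContDiff ℝ (⊤ : ℕ∞) θ → HasCompactSupport θ →
      ∫ y, P y * (Δ θ) y = -∫ y, fderiv ℝ (fderiv ℝ θ) y (V y) (V y))
    (hEE : ∀ θ : EuclideanSpace ℝ (Fin 3) → ℝ, IsTestFunctionOn (⊤ : Opens (EuclideanSpace ℝ (Fin 3))) θ →
      (2 - 5 * g) * ∫ x, θ x * ‖V x‖ ^ 2 =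
        (∫ x, (‖V x‖ ^ 2 + 2 * P x) * ⟪V x, gradient θ x⟫) +
          g * ∫ x, ‖V x‖ ^ 2 * ⟪x, gradient θ x⟫) :
    ∃ Ninf : ℝ, Tendsto (fun L : ℝ => L ^ (2 / g - 5) * ∫ y, σ (L⁻¹ • y) * ‖V y‖ ^ 2) atTop (𝓝 Ninf) := by
  have hc0 : (0 : ℝ) ≤ c := c.2
  have hg0 : 0 < g := by linarith
  have hκ0 : 2 / g - 5 ≤ 0 := by rw [sub_nonpos, div_le_iff₀ hg0]; linarith
  have hV2 : LocallyIntegrable (fun y => ‖V y‖ ^ 2) volume := locallyIntegrable_norm_sq_of_growth_loc hVm hA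
  set J : ℝ → ℝ := fun R => ∫ y, σ (R⁻¹ • y) * ‖V y‖ ^ 2 with hJ
  set F : ℝ → ℝ := fun r => ∫ x, (‖V x‖ ^ 2 + 2 * P x) * ⟪V x, gradient (fun z => σ (r⁻¹ • z)) x⟫ with hF
  have hJ0 : ∀ R : ℝ, 0 < R → 0 ≤ J R := fun R _ =>
    integral_nonneg fun y => mul_nonneg (h0 _) (sq_nonneg _)
  have hEEσ : ∀ L : ℝ, 0 < L → (2 - 5 * g) * ∫ x, σ (L⁻¹ • x) * ‖V x‖ ^ 2 =
      (∫ x, (‖V x‖ ^ 2 + 2 * P x) * ⟪V x, gradient (fun z => σ (L⁻¹ • z)) x⟫) +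
        g * ∫ x, ‖V x‖ ^ 2 * ⟪x, gradient (fun z => σ (L⁻¹ • z)) x⟫ :=
    fun L hL => hEE _ (isTestFunctionOn_comp_inv_smul hσ hL.ne')
  have hderiv : ∀ r : ℝ, 0 < r →
      HasDerivAt (fun L : ℝ => L ^ (2 / g - 5) * J L) (g⁻¹ * r ^ (2 / g - 6) * F r) r :=
    fun r hr => hasDerivAt_rpowMul_cutoffEnergy_of_energyEquality hg0.ne' hσ hVm hV2 hr (hEEσ r hr)
  -- the flux weight `w`
  set w : ℝ → ℝ := fun r => g⁻¹ * r ^ (2 / g - 6) * F r with hw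
  have hwcont : ∀ r : ℝ, 0 < r → ContinuousAt w r := fun r hr =>
    continuousAt_ownRate_fluxWeight hg0.ne' hσ hVm hV2 hEEσ hr
  -- ### an integrable majorant of `w` on some `(L₁, ∞)`
  have hmaj : ∃ L₁ B e : ℝ, 1 ≤ L₁ ∧ 0 ≤ B ∧ e < -1 ∧ ∀ r : ℝ, L₁ ≤ r → |w r| ≤ B * r ^ e := by
    by_cases hc : (c : ℝ) = 0
    · -- `c = 0`: `J ≡ 0` on `[1,∞)`, so `L^κ J(L)` is locally constant on `(1,∞)` and its derivative `w` vanishes there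
      refine ⟨2, 0, -2, by norm_num, le_rfl, by norm_num, fun r hr => ?_⟩
      have hr1 : 1 < r := by linarith
      have hr0 : 0 < r := by linarith
      have hJz : ∀ R : ℝ, 1 ≤ R → J R = 0 := by
        intro R hR
        have hR0 : 0 < R := lt_of_lt_of_le one_pos hR
        have h := normEnergy_le_of_growth_loc (ρ := ρ) h0 h1 hzero hVm hA hR
        rw [hc, mul_zero] at h
        have hRp : 0 < R ^ (2 * ρ - 1) := Real.rpow_pos_of_pos hR0 _
        have hJle : J R ≤ 0 := by
          have : R ^ (2 * ρ - 1) * J R ≤ R ^ (2 * ρ - 1) * 0 := by rw [mul_zero]; exact h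
          exact le_of_mul_le_mul_left this hRp
        exact le_antisymm hJle (hJ0 R hR0)
      have hloc : (fun L : ℝ => L ^ (2 / g - 5) * J L) =ᶠ[𝓝 r] fun _ => (0 : ℝ) := by
        filter_upwards [Ioi_mem_nhds hr1] with L hL
        rw [hJz L (le_of_lt hL), mul_zero]
      have hd0 : HasDerivAt (fun L : ℝ => L ^ (2 / g - 5) * J L) 0 r :=
        (hasDerivAt_const r (0 : ℝ)).congr_of_eventuallyEq hloc
      have hz := (hderiv r hr0).unique hd0
      show |w r| ≤ 0 * r ^ (-2 : ℝ)
      simp only [hw]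
      rw [hz, abs_zero, zero_mul]
    have hcpos : 0 < (c : ℝ) := lt_of_le_of_ne hc0 (Ne.symm hc)
    obtain ⟨A, hA0, hfluxW⟩ := exists_fluxWeight_le_of_sup_loc hρ hρ1 hσ h0 h1 hone hzero hVm hPm hGm hVG hA hE hD
      hPoisson
    have hflux : ∀ S : ℝ, 0 ≤ S → S ≤ 3 * c → ∀ L : ℝ, 1 ≤ L →
        (∀ R : ℝ, L ≤ R → J R ≤ R ^ (1 - 2 * ρ) * S) →
        ∀ r : ℝ, L ≤ r → |(2 + ρ) * r ^ (2 * ρ - 2) * F r| ≤ A * S ^ (1 / 2 : ℝ) * r ^ (-1 - (2 + ρ) / 4) :=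
      fun S hS hS3 L hL hsup r hr => hfluxW S hS hS3 L hL hsup r hr
    set C₀ : ℝ := (3 : ℝ) ^ (1 - 2 * ρ) * c with hC₀
    have hC₀0 : 0 ≤ C₀ := by rw [hC₀]; positivity
    have hC₀3 : C₀ ≤ 3 * c := by
      have h3 : (3 : ℝ) ^ (1 - 2 * ρ) ≤ 3 := by
        conv_rhs => rw [← Real.rpow_one 3]
        exact Real.rpow_le_rpow_of_exponent_le (by norm_num) (by linarith)
      rw [hC₀]; gcongr
    have hbase : ∀ R : ℝ, 1 ≤ R → J R ≤ C₀ * R ^ (1 - 2 * ρ) := by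
      intro R hR
      have hR0 : 0 < R := lt_of_lt_of_le one_pos hR
      have h := normEnergy_le_of_growth_loc (ρ := ρ) h0 h1 hzero hVm hA hR
      have hRR : R ^ (1 - 2 * ρ) * R ^ (2 * ρ - 1) = 1 := by rw [← Real.rpow_add hR0]; norm_num
      calc J R = R ^ (1 - 2 * ρ) * (R ^ (2 * ρ - 1) * J R) := by rw [← mul_assoc, hRR, one_mul]
        _ ≤ R ^ (1 - 2 * ρ) * ((3 : ℝ) ^ (1 - 2 * ρ) * c) :=
            mul_le_mul_of_nonneg_left h (Real.rpow_nonneg hR0.le _)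
        _ = C₀ * R ^ (1 - 2 * ρ) := by rw [hC₀]; ring
    obtain ⟨m, C, L₁, hm, hC, hL₁, hb, h3c, hκμ⟩ :=
      exists_admissible_bound_ownRate hρ hg0 hκ0 hcpos hA0 hJ0 hflux hderiv hC₀0 hC₀3 hbase
    have hFle := abs_flux_le_rpow_of_bound hρ hflux hm hC hL₁ hb h3c
    refine ⟨L₁, g⁻¹ * (A * C ^ (1 / 2 : ℝ) / (2 + ρ)), (2 / g - 6) + (m / 2 - 5 * ρ / 4), hL₁, by positivity,
      by linarith, fun r hr => ?_⟩
    have hr0 : 0 < r := lt_of_lt_of_le (lt_of_lt_of_le one_pos hL₁) hr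
    have h := hFle r hr
    simp only [hw]
    rw [abs_mul, abs_mul, abs_of_pos (inv_pos.2 hg0), abs_of_nonneg (Real.rpow_nonneg hr0.le _), Real.rpow_add hr0]
    calc g⁻¹ * r ^ (2 / g - 6) * |F r| ≤ g⁻¹ * r ^ (2 / g - 6) * (A * C ^ (1 / 2 : ℝ) / (2 + ρ) * r ^ (m / 2 - 5 * ρ / 4)) :=
          mul_le_mul_of_nonneg_left h (mul_nonneg (inv_nonneg.2 hg0.le) (Real.rpow_nonneg hr0.le _))
      _ = g⁻¹ * (A * C ^ (1 / 2 : ℝ) / (2 + ρ)) * (r ^ (2 / g - 6) * r ^ (m / 2 - 5 * ρ / 4)) := by ring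
  obtain ⟨L₁, B, e, hL₁, hB, he, hwle⟩ := hmaj
  have hL₁0 : 0 < L₁ := lt_of_lt_of_le one_pos hL₁
  -- ### `w` is integrable on `(L₁, ∞)` and `Ñ(L) = Ñ(L₁) + ∫_{L₁}^L w`
  have hwcontOn : ContinuousOn w (Ici L₁) := fun r hr => (hwcont r (hL₁0.trans_le hr)).continuousWithinAt
  have hwint : IntegrableOn w (Ioi L₁) volume := by
    have hbound : IntegrableOn (fun r : ℝ => B * r ^ e) (Ioi L₁) volume :=
      ((integrableOn_Ioi_rpow_of_lt he hL₁0).const_mul _)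
    refine Integrable.mono' hbound ((hwcontOn.mono Ioi_subset_Ici_self).aestronglyMeasurable measurableSet_Ioi) ?_
    rw [ae_restrict_iff' measurableSet_Ioi]
    refine Eventually.of_forall fun r hr => ?_
    rw [Real.norm_eq_abs]
    exact hwle r (le_of_lt hr)
  have hlim := intervalIntegral_tendsto_integral_Ioi L₁ hwint tendsto_id
  refine ⟨L₁ ^ (2 / g - 5) * J L₁ + ∫ r in Ioi L₁, w r, ?_⟩
  refine ((tendsto_const_nhds.add hlim).congr' ?_)
  filter_upwards [eventually_ge_atTop L₁] with L hL
  -- FTC on `[L₁, L]`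
  have hderivI : ∀ r ∈ uIcc L₁ L, HasDerivAt (fun L : ℝ => L ^ (2 / g - 5) * J L) (w r) r := by
    intro r hr
    rw [uIcc_of_le hL] at hr
    exact hderiv r (hL₁0.trans_le hr.1)
  have hcontI : ContinuousOn w (uIcc L₁ L) := by
    rw [uIcc_of_le hL]; exact hwcontOn.mono Icc_subset_Ici_self
  have hftc := intervalIntegral.integral_eq_sub_of_hasDerivAt hderivI (hcontI.intervalIntegrable)
  simp only [id]
  linarith

end EnergySaturation

namespace SlowClock

variable {ρ g T T₁ : ℝ} {x₀ : EuclideanSpace ℝ (Fin 3)} {σ : EuclideanSpace ℝ (Fin 3) → ℝ}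
  {u : ℝ → EuclideanSpace ℝ (Fin 3) → EuclideanSpace ℝ (Fin 3)} {p : ℝ → EuclideanSpace ℝ (Fin 3) → ℝ}
  {H : ℝ → EuclideanSpace ℝ (Fin 3) → EuclideanSpace ℝ (Fin 3) →L[ℝ] EuclideanSpace ℝ (Fin 3)} {c : ℝ≥0}
  {W : EuclideanSpace ℝ (Fin 3) → EuclideanSpace ℝ (Fin 3)} {P : EuclideanSpace ℝ (Fin 3) → ℝ}

/-- **THE TWO-SIDED OWN-RATE LAW (member level).**  Crux hypotheses verbatim (`0 < ρ ≤ ½`, weak class) + exact self-similarity of `(u, p)` about `(T, x₀)` at a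
rate `g ∈ [2/5, ½]` FOR `τ < T₁` ONLY (`T₁ ≤ 0`, `T₁ ≤ T`): for every cut-off `σ` (`0 ≤ σ ≤ 1`, `σ = 1` on `B̄₁`, `σ = 0` off `B₂`) the own-rate normalised
profile energy `L^{2/g−5}∫σ(L⁻¹y)|W|²` converges as `L → ∞`; by `…OwnRateSubExtremalPast` the limit is `> 0` unless `u = 0` a.e.
[folklore; cf. BronziShvydkoy2015 Thm 1.1, Rem 1.4] -/
theorem tendsto_ownRate_normEnergy_past (hρ : 0 < ρ) (hρh : ρ ≤ 1 / 2) (hT₁ : T₁ ≤ 0) (hTT₁ : T₁ ≤ T)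
    (x₀ : EuclideanSpace ℝ (Fin 3))
    (hsw : IsSuitableWeakSolutionOn (slab (EuclideanSpace ℝ (Fin 3)) (Iio 0) isOpen_Iio) 0 0 u p)
    (hH : HasWeakSpatialGradientOn (slab (EuclideanSpace ℝ (Fin 3)) (Iio 0) isOpen_Iio) u H)
    (hgauge : ∀ a : ℝ, 0 < a →
      ENNReal.ofReal (a ^ (2 * ρ)) * cknA a (0 : ℝ × EuclideanSpace ℝ (Fin 3)) u +
          ENNReal.ofReal (a ^ ρ) * cknE a (0 : ℝ × EuclideanSpace ℝ (Fin 3)) H +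
        ENNReal.ofReal (a ^ (2 * ρ)) * cknD a (0 : ℝ × EuclideanSpace ℝ (Fin 3)) p ≤ (c : ℝ≥0∞))
    (hg25 : 2 / 5 ≤ g) (hg2 : 2 * g ≤ 1)
    (hu : ∀ τ : ℝ, τ < T₁ → u τ = fun x => selfSimilarCollapse g T W τ (x - x₀))
    (hp : ∀ τ : ℝ, τ < T₁ → p τ = fun x => selfSimilarCollapsePressure g T P τ (x - x₀))
    (hσ : IsTestFunctionOn (⊤ : Opens (EuclideanSpace ℝ (Fin 3))) σ) (h0 : ∀ z, 0 ≤ σ z)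
    (h1 : ∀ z, σ z ≤ 1) (hone : ∀ z, ‖z‖ ≤ 1 → σ z = 1) (hzero : ∀ z, 2 ≤ ‖z‖ → σ z = 0) :
    ∃ Ninf : ℝ, Tendsto (fun L : ℝ => L ^ (2 / g - 5) * ∫ y, σ (L⁻¹ • y) * ‖W y‖ ^ 2) atTop (𝓝 Ninf) := by
  have hρ1 : ρ < 1 := by linarith
  have hg0 : 0 < g := by linarith
  obtain ⟨G, c', hWm, hPm, hGm, hWG, hA₁, hE₁, hD₁, hPoisson, hEE⟩ :=
    exists_locData_past_rate hρ hρh hT₁ hTT₁ x₀ hsw hH hgauge hg0.le hg2 hu hp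
  exact EnergySaturation.tendsto_ownRate_normEnergy_loc hρ hρ1 hg25 hσ h0 h1 hone hzero hWm hPm hGm hWG
    hA₁ hE₁ hD₁ hPoisson hEE

end SlowClock

end Summit.NavierStokesRegularity.NavierStokesRegularity.Theorems.PowerGaugeEulerLiouville

end
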